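import Literature.Geometry.Riemannian.HConcentrationOfDistributional
import Literature.Geometry.Riemannian.VarianceMonotoneOfBarrier
import HarnessLib

/-!
# `H`-concentration of the metric flow of a compact Ricci flow from the BARRIER form of the
# distance-distortion inequality (Bamler 2020a, Thm. 3.5 ⇒ Cor. 3.6 ⇒ Cor. 3.7; Bamler 2023, §3.7)

Companion of `HConcentrationOfDistributional.lean`. There the input was the distributional form
of Bamler's Thm. 3.5; here it is the BARRIER form, which is how Thm. 3.5 is stated and proved in
R. Bamler, *Entropy and heat kernel bounds on a Ricci flow background*, arXiv:2008.07093 (2020a),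
§3: at every `(x, y, t)` and for every `η > 0`, `d_t²(x, y)` admits an upper barrier `b ≥ d²`
near `(x, y, t)`, touching at the point, smooth, with `(∂ₜ − Δ_x − Δ_y) b ≥ −H_n − η` at the
point. The monotonicity of `t ↦ ∫∫ d_t² dν_{x₁,t₀;t} dν_{x₂,t₀;t} + H t` for the heat kernel
measures (Cor. 3.6 for kernels) is `kernel_integral_integral_distSq_sub_ge_of_barrier`
(`VarianceMonotoneOfBarrier.lean`); this file runs the limiting argument of Cor. 3.7 on it:

* `IsRicciFlow.integral_integral_distSq_heatKernelMeasure_le_of_kernelMonotone` — the passage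
  from the monotonicity on compact sub-intervals `[r₁, r₂] ⊂ (s, t)` to
  `∫∫ d_s² dν_{x₂,t;s} dν_{x₁,t;s} ≤ d_t²(x₁, x₂) + H (t − s)` (weak limits at both ends);
* `IsRicciFlow.integral_integral_distSq_heatKernelMeasure_le_of_barrier` — the same from the
  barrier hypothesis;
* `isHConcentrated_ricciFlowMetricFlow_of_barrier` — `(ricciFlowMetricFlow …).IsHConcentrated H`.

The barrier property is a HYPOTHESIS (Bamler's Thm. 3.5); everything else is proved; no
definitions, no named facts.

## References

* R. H. Bamler, *Entropy and heat kernel bounds on a Ricci flow background*, arXiv:2008.07093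
  (2020), §3, Thm. 3.5, Cor. 3.6, Cor. 3.7. [Bamler2020Entropy]
* R. H. Bamler, *Compactness theory of the space of super Ricci flows*, Invent. Math. 233 (2023),
  §3.4, §3.7. [Bamler2023]
-/

noncomputable section

open Bundle Set Function Filter Manifold MeasureTheory Measure TopologicalSpace
open scoped Manifold ContDiff Topology ENNReal NNReal

namespace Literature.Geometry.Riemannian

open Lorentzian Lorentzian.PseudoRiemannianMetric Literature.MeasureTheory.Integral

universe u

section HConcentrationBarrier

variable {m : ℕ} {H : Type*} [TopologicalSpace H]
  {I : ModelWithCorners ℝ (EuclideanSpace ℝ (Fin m)) H} [I.Boundaryless]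
  {M : Type u} [TopologicalSpace M] [ChartedSpace H M] [IsManifold I ∞ M]
  [T2Space M] [CompactSpace M] [SecondCountableTopology M] [MeasurableSpace M] [BorelSpace M]
  [ConnectedSpace M]
  {h : ℝ → PseudoRiemannianMetric I ∞ (EuclideanSpace ℝ (Fin m)) (TangentSpace I : M → Type _)}
  (hh : IsContMDiffFamilyOn ∞ h univ) (hR : ∀ r, (h r).IsRiemannian)
  {cov : ℝ → CovariantDerivative I (EuclideanSpace ℝ (Fin m)) (TangentSpace I : M → Type _)}

/-- **From the monotonicity of `r ↦ ∫∫ d_r² dν_{x₂,t;r} dν_{x₁,t;r} + H r` on compact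
sub-intervals of `(s, t)` to `∫∫ d_s² dν_{x₂,t;s} dν_{x₁,t;s} ≤ d_t²(x₁, x₂) + H (t − s)`** (the
limiting argument of Bamler 2020a, Cor. 3.7: `r₂ ↗ t` using `ν_{xᵢ,t;r} → δ_{xᵢ}` weakly and
`d_r² → d_t²` uniformly, then `r₁ ↘ s`). [cite: Bamler2020Entropy, §3, Cor. 3.7] -/
theorem IsRicciFlow.integral_integral_distSq_heatKernelMeasure_le_of_kernelMonotone {s t : ℝ}
    (hst : s < t) (hflow : IsRicciFlow h cov (Icc s t)) {Hc : ℝ} (x₁ x₂ : M)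
    (hA : ∀ r₁ r₂, s < r₁ → r₁ < r₂ → r₂ < t → -Hc * (r₂ - r₁) ≤
      (∫ y₁, ∫ y₂, ((h r₂).edist (hR r₂) y₁ y₂).toReal ^ 2 ∂(heatKernelMeasure hh hR t x₂ r₂)
          ∂(heatKernelMeasure hh hR t x₁ r₂)) -
        ∫ y₁, ∫ y₂, ((h r₁).edist (hR r₁) y₁ y₂).toReal ^ 2 ∂(heatKernelMeasure hh hR t x₂ r₁)
          ∂(heatKernelMeasure hh hR t x₁ r₁)) :
    ∫ y₁, ∫ y₂, ((h s).edist (hR s) y₁ y₂).toReal ^ 2 ∂(heatKernelMeasure hh hR t x₂ s)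
        ∂(heatKernelMeasure hh hR t x₁ s) ≤
      ((h t).edist (hR t) x₁ x₂).toReal ^ 2 + Hc * (t - s) := by
  -- notation
  set u : M → M → ℝ → ℝ := fun y₁ y₂ r ↦ ((h r).edist (hR r) y₁ y₂).toReal ^ 2 with hu
  set ν₁ : ℝ → Measure M := fun r ↦ heatKernelMeasure hh hR t x₁ r with hν₁
  set ν₂ : ℝ → Measure M := fun r ↦ heatKernelMeasure hh hR t x₂ r with hν₂
  set Fm : ℝ → ℝ := fun r ↦ ∫ y₁, ∫ y₂, u y₁ y₂ r ∂ν₂ r ∂ν₁ r with hFm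
  have huc : ∀ r, Continuous fun q : M × M ↦ u q.1 q.2 r := fun r ↦
    (ENNReal.continuousOn_toReal.comp_continuous (PseudoRiemannianMetric.continuous_edist (hR r))
      fun p ↦ PseudoRiemannianMetric.edist_ne_top (hR r) p.1 p.2).pow 2
  replace hA : ∀ r₁ r₂, s < r₁ → r₁ < r₂ → r₂ < t → -Hc * (r₂ - r₁) ≤ Fm r₂ - Fm r₁ := hA
  ----------------------------------------------------------------
  -- Step B: weak continuity of the kernels and uniform continuity of `u`
  ----------------------------------------------------------------
  have hweak : ∀ (x : M) (r₀ : ℝ) (φ : M → ℝ), Continuous φ →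
      Tendsto (fun r ↦ ∫ y, φ y ∂(heatKernelMeasure hh hR t x r)) (𝓝 r₀)
        (𝓝 (∫ y, φ y ∂(heatKernelMeasure hh hR t x r₀))) := fun x r₀ φ hφ ↦
    (continuous_integral_heatKernelMeasure_left hh hR t x hφ).tendsto r₀
  have hunif : ∀ r₀ ∈ Icc s t, TendstoUniformly (fun r (q : M × M) ↦ u q.1 q.2 r)
      (fun q ↦ u q.1 q.2 r₀) (𝓝[Ioo s t] r₀) := by
    intro r₀ hr₀
    have h1 := hflow.tendstoUniformly_edist_toReal_sq hst.le hR hr₀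
    rw [Metric.tendstoUniformly_iff] at h1 ⊢
    intro ε hε
    exact (h1 ε hε).filter_mono (nhdsWithin_mono _ Ioo_subset_Icc_self)
  have hlim : ∀ r₀ ∈ Icc s t, Tendsto Fm (𝓝[Ioo s t] r₀) (𝓝 (Fm r₀)) := by
    intro r₀ hr₀
    have := tendsto_integral_integral_of_tendsto (X := M) (l := 𝓝[Ioo s t] r₀) (μ := ν₁) (ν := ν₂)
      (μ₀ := ν₁ r₀) (ν₀ := ν₂ r₀)
      (fun φ hφ ↦ (hweak x₁ r₀ φ hφ).mono_left nhdsWithin_le_nhds)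
      (fun φ hφ ↦ (hweak x₂ r₀ φ hφ).mono_left nhdsWithin_le_nhds)
      (D := fun q : M × M ↦ u q.1 q.2 r₀) (huc r₀) (Di := fun r (q : M × M) ↦ u q.1 q.2 r)
      (fun r ↦ huc r) (hunif r₀ hr₀)
    exact this
  -- the filters at the two ends are nontrivial
  have hcl : closure (Ioo s t) = Icc s t := closure_Ioo hst.ne
  haveI hbt : (𝓝[Ioo s t] t).NeBot := mem_closure_iff_nhdsWithin_neBot.1 (hcl ▸ right_mem_Icc.2 hst.le)
  haveI hbs : (𝓝[Ioo s t] s).NeBot := mem_closure_iff_nhdsWithin_neBot.1 (hcl ▸ left_mem_Icc.2 hst.le)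
  -- `Fm t = d_t²(x₁, x₂)`
  have hFt : Fm t = u x₁ x₂ t := by
    simp only [hFm, hν₁, hν₂, heatKernelMeasure_self, integral_dirac]
  ----------------------------------------------------------------
  -- Step C: `r₂ ↗ t`, then `r₁ ↘ s`
  ----------------------------------------------------------------
  have hC : ∀ r₁ ∈ Ioo s t, Fm r₁ ≤ u x₁ x₂ t + Hc * (t - r₁) := by
    intro r₁ hr₁
    have hg : Tendsto (fun r₂ ↦ Fm r₂ + Hc * (r₂ - r₁)) (𝓝[Ioo s t] t) (𝓝 (Fm t + Hc * (t - r₁))) :=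
      (hlim t ⟨hst.le, le_rfl⟩).add (((continuous_const.mul (continuous_id.sub continuous_const)).tendsto t).mono_left
        nhdsWithin_le_nhds)
    rw [hFt] at hg
    refine ge_of_tendsto hg ?_
    have hev : ∀ᶠ r₂ in 𝓝[Ioo s t] t, r₁ < r₂ :=
      mem_nhdsWithin_of_mem_nhds (Ioi_mem_nhds hr₁.2)
    filter_upwards [hev, self_mem_nhdsWithin] with r₂ h12 hr₂
    have := hA r₁ r₂ hr₁.1 h12 hr₂.2
    linarith
  have hD : Tendsto (fun r₁ ↦ u x₁ x₂ t + Hc * (t - r₁)) (𝓝[Ioo s t] s) (𝓝 (u x₁ x₂ t + Hc * (t - s))) :=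
    ((continuous_const.add (continuous_const.mul (continuous_const.sub continuous_id))).tendsto s).mono_left
      nhdsWithin_le_nhds
  exact le_of_tendsto_of_tendsto (hlim s ⟨le_rfl, hst.le⟩) hD
    (eventually_nhdsWithin_of_forall fun r₁ hr₁ ↦ hC r₁ hr₁)


/-- **`∫∫ d_s² dν_{x₂,t;s} dν_{x₁,t;s} ≤ d_t²(x₁, x₂) + H (t − s)` from the barrier form of
Thm. 3.5** on `(s, t)`. [cite: Bamler2020Entropy, §3, Cor. 3.7] -/
theorem IsRicciFlow.integral_integral_distSq_heatKernelMeasure_le_of_barrier {s t : ℝ}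
    (hst : s < t) (hflow : IsRicciFlow h cov (Icc s t)) {Hc : ℝ}
    (hbar : ∀ x y, ∀ r ∈ Ioo s t, ∀ η > 0, ∃ b : M → M → ℝ → ℝ,
      (∀ᶠ p in 𝓝 ((x, y, r) : M × M × ℝ),
        ((h p.2.2).edist (hR p.2.2) p.1 p.2.1).toReal ^ 2 ≤ b p.1 p.2.1 p.2.2) ∧
      b x y r = ((h r).edist (hR r) x y).toReal ^ 2 ∧
      (∀ᶠ x' in 𝓝 x, ContMDiffAt I 𝓘(ℝ, ℝ) 2 (fun x'' ↦ b x'' y r) x') ∧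
      (∀ᶠ y' in 𝓝 y, ContMDiffAt I 𝓘(ℝ, ℝ) 2 (fun y'' ↦ b x y'' r) y') ∧
      ∃ db : ℝ, HasDerivAt (fun s' ↦ b x y s') db r ∧
        -Hc - η ≤ db - (h r).laplaceBeltrami (fun x' ↦ b x' y r) x -
          (h r).laplaceBeltrami (fun y' ↦ b x y' r) y)
    (x₁ x₂ : M) :
    ∫ y₁, ∫ y₂, ((h s).edist (hR s) y₁ y₂).toReal ^ 2 ∂(heatKernelMeasure hh hR t x₂ s)
        ∂(heatKernelMeasure hh hR t x₁ s) ≤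
      ((h t).edist (hR t) x₁ x₂).toReal ^ 2 + Hc * (t - s) :=
  hflow.integral_integral_distSq_heatKernelMeasure_le_of_kernelMonotone hh hR hst x₁ x₂
    fun _ _ hsr₁ h12 hr₂t ↦
      hflow.kernel_integral_integral_distSq_sub_ge_of_barrier hh hR ⟨hst, le_rfl⟩ x₁ x₂ hsr₁ h12
        hr₂t fun x y r hr η hη ↦ hbar x y r ⟨hsr₁.trans hr.1, hr.2.trans_lt hr₂t⟩ η hη

/-- **The metric flow of a compact Ricci flow is `H`-concentrated, given the barrier form of the
distance-distortion inequality at every point `(x, y, r)` whose time `r ∈ S` is not the initial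
time** (Bamler 2020a, Thm. 3.5 ⇒ Cor. 3.7 ⇒ Bamler 2023, §3.7).
[cite: Bamler2020Entropy, §3, Cor. 3.7] -/
theorem isHConcentrated_ricciFlowMetricFlow_of_barrier {S : Set ℝ} (hS : S.OrdConnected)
    (hflow : IsRicciFlow h cov S) {Hc : ℝ}
    (hbar : ∀ x y r, r ∈ S → (∃ s ∈ S, s < r) → ∀ η > 0, ∃ b : M → M → ℝ → ℝ,
      (∀ᶠ p in 𝓝 ((x, y, r) : M × M × ℝ),
        ((h p.2.2).edist (hR p.2.2) p.1 p.2.1).toReal ^ 2 ≤ b p.1 p.2.1 p.2.2) ∧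
      b x y r = ((h r).edist (hR r) x y).toReal ^ 2 ∧
      (∀ᶠ x' in 𝓝 x, ContMDiffAt I 𝓘(ℝ, ℝ) 2 (fun x'' ↦ b x'' y r) x') ∧
      (∀ᶠ y' in 𝓝 y, ContMDiffAt I 𝓘(ℝ, ℝ) 2 (fun y'' ↦ b x y'' r) y') ∧
      ∃ db : ℝ, HasDerivAt (fun s' ↦ b x y s') db r ∧
        -Hc - η ≤ db - (h r).laplaceBeltrami (fun x' ↦ b x' y r) x -
          (h r).laplaceBeltrami (fun y' ↦ b x y' r) y) :
    (ricciFlowMetricFlow hh hR hS hflow).IsHConcentrated Hc := by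
  intro s t hst x₁ x₂
  change ∫⁻ y₁, ∫⁻ y₂, (h s).edist (hR s) y₁ y₂ ^ 2 ∂(heatKernelMeasure hh hR t x₂ s)
      ∂(heatKernelMeasure hh hR t x₁ s) ≤
    (h t).edist (hR t) x₁ x₂ ^ 2 + ENNReal.ofReal (Hc * ((t : ℝ) - s))
  have hfin : ∀ (r : ℝ) (y₁ y₂ : M), (h r).edist (hR r) y₁ y₂ ≠ ⊤ := fun r y₁ y₂ ↦
    PseudoRiemannianMetric.edist_ne_top (hR r) y₁ y₂
  have hsq : ∀ (r : ℝ) (y₁ y₂ : M), (h r).edist (hR r) y₁ y₂ ^ 2 =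
      ENNReal.ofReal (((h r).edist (hR r) y₁ y₂).toReal ^ 2) := fun r y₁ y₂ ↦ by
    rw [ENNReal.ofReal_pow ENNReal.toReal_nonneg, ENNReal.ofReal_toReal (hfin r y₁ y₂)]
  rcases eq_or_lt_of_le hst with heq | hlt
  · have hst' : (t : ℝ) ≤ s := heq.ge
    rw [heatKernelMeasure_of_le hh hR hst', heatKernelMeasure_of_le hh hR hst', lintegral_dirac,
      lintegral_dirac]
    have : (s : ℝ) = t := heq
    obtain ⟨s, hs⟩ := s
    obtain ⟨t, ht⟩ := t
    simp only at this
    subst this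
    exact le_self_add
  · have hsub : Icc (s : ℝ) t ⊆ S := hS.out s.2 t.2
    have hflow' : IsRicciFlow h cov (Icc (s : ℝ) t) := hflow.mono hsub
    have key := hflow'.integral_integral_distSq_heatKernelMeasure_le_of_barrier hh hR hlt
      (fun x y r hr η hη ↦ hbar x y r (hsub (Ioo_subset_Icc_self hr)) ⟨s, s.2, hr.1⟩ η hη) x₁ x₂
    have huc : Continuous fun q : M × M ↦ ((h s).edist (hR s) q.1 q.2).toReal ^ 2 :=
      (ENNReal.continuousOn_toReal.comp_continuous (PseudoRiemannianMetric.continuous_edist (hR s))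
        fun p ↦ hfin s p.1 p.2).pow 2
    have hG : Continuous fun y₁ ↦ ∫ y₂, ((h s).edist (hR s) y₁ y₂).toReal ^ 2
        ∂(heatKernelMeasure hh hR t x₂ s) :=
      continuous_integral_of_continuous_prod (heatKernelMeasure hh hR t x₂ s) huc
    have hinner : ∀ y₁, ∫⁻ y₂, (h s).edist (hR s) y₁ y₂ ^ 2 ∂(heatKernelMeasure hh hR t x₂ s) =
        ENNReal.ofReal (∫ y₂, ((h s).edist (hR s) y₁ y₂).toReal ^ 2 ∂(heatKernelMeasure hh hR t x₂ s)) := by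
      intro y₁
      simp_rw [hsq]
      rw [ofReal_integral_eq_lintegral_ofReal]
      · exact (huc.comp (Continuous.prodMk_right y₁)).integrable_of_hasCompactSupport
          (HasCompactSupport.of_compactSpace _)
      · exact Eventually.of_forall fun y₂ ↦ sq_nonneg _
    simp_rw [hinner]
    rw [← ofReal_integral_eq_lintegral_ofReal (hG.integrable_of_hasCompactSupport
        (HasCompactSupport.of_compactSpace _)) (Eventually.of_forall fun y₁ ↦
          integral_nonneg fun y₂ ↦ sq_nonneg _)]
    calc ENNReal.ofReal (∫ y₁, ∫ y₂, ((h s).edist (hR s) y₁ y₂).toReal ^ 2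
          ∂(heatKernelMeasure hh hR t x₂ s) ∂(heatKernelMeasure hh hR t x₁ s))
        ≤ ENNReal.ofReal (((h t).edist (hR t) x₁ x₂).toReal ^ 2 + Hc * (t - s)) :=
          ENNReal.ofReal_le_ofReal key
      _ ≤ ENNReal.ofReal (((h t).edist (hR t) x₁ x₂).toReal ^ 2) + ENNReal.ofReal (Hc * (t - s)) :=
          ENNReal.ofReal_add_le
      _ = (h t).edist (hR t) x₁ x₂ ^ 2 + ENNReal.ofReal (Hc * ((t : ℝ) - s)) := by rw [← hsq]

end HConcentrationBarrier

end Literature.Geometry.Riemannian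

end
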